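import Summits.ABC.IUTFork.Repair.RHHullCellSlackSum
import HarnessLib

/-!
# R-H ROUND 3, AXIS D2 — THE HEIGHT-SCALING BARRIER AT THE DATUM LEVEL, in the integer cell currency of record: the full-price ENVELOPE of a
# datum (every cell of every bad place credited its whole exact price — the EX/across-netting tier, which dominates every combination of the
# six object classes) is HEIGHT-FREE between two explicit caps, the demand is the height times a cubic, so the netted requirement FAILS at
# every dilation beyond an explicit `s₀⁺` and HOLDS below an explicit `s₀⁻` — a closed-form two-sided BRACKET on FINAL (1)(e)'s crossing `s×`
# (PROOF-ONLY, 0 definitions)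

abc-iut cell, rung LADDER-ABC:A2.RESCUE.H, round-3 AXIS D2 (21-frontier 2026-08-27T11:38:40Z; D-0130; KEY `wake/KEY-abc-iut-rh2-w-2-D2-TYPE-BARRIER.md`;
desk `plan/rescue/R-H/ROUND3/AXIS-CD-DESK.md` §D2). Seat abc-iut-rh2-w-2 = AXIS-D2 TYPER 1 of 2 (BARRIER); companion of this seat's abstract barrier
`Repair/RHHeightScalingBarrier.lean` (p531802: `Barrier`, `barrier_holds`, `barrierScale`, `not_closedBy_of_heightFree`) and of abc-iut-rh2-T-1's vocabulary
`Repair/RHHeightScaling.lean` (`ExponentAtMost`, `Door`, `price`, `priceCap`, one-place crossing `sum_demand_sub_price_pos_of_lt` with the linear cap) —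
neither is imported (both in the review lane at filing time); every statement below is spelled out over abc-iut-rh-typ-3's ACCEPTED summed law
`Repair/RHHullCellSlackSum.lean` (`two_mul_sum_labels_eq`, `six_mul_sum_demand_eq`, `sum_price_ge`) and abc-iut-rh2-w-2's `RHHullCellSlice.gain_bounds` BY NAME.

CURRENCY (MIN-SLICE §(i)/(i-w2).1; FINAL c9ab8e0bbc43dc94 (1)(d)/(e); the R78 ray): a DATUM is a finite family of bad places `w : Fin n`, each a conjugate
fibre with integers `e_w > 0` (ramification), `m_w ≥ 0` (depth `m_q(w)` at the tabulated height), `δ_w` (different exponent), `r_in(w) ≥ r_out(w)` (log-shell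
radii, span `G_w := r_in − r_out`), a common label range `j = 1 … L` (`L = l⋆`), and a WEIGHT `c_w ≥ 0` (reals: the capsule weight `(n_w/[K:ℚ])·(log p_w)/(e_w·l⋆)`
turning cell units into nats). HEIGHT DILATION `s : ℤ`: `m_w ↦ s·m_w` at every place simultaneously (places and `l` fixed). Per cell: DEMAND `((j²−1)·s·m_w`,
EXACT PRICE `price_j(w,s) = j·δ_w + (j+1)·G_w + ρ`, `ρ = (j²·s·m_w − j·δ_w − (j+1)·r_in(w)) mod e_w ∈ [0, e_w − 1]` (`RH.HullCellSlice.hullCellδ_iff_demand_le_price`).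
The FULL-PRICE ENVELOPE `ENV(s) := Σ_w c_w·Σ_j price_j(w,s)` is what the TOP tier (EX information × across-place netting, print's reading, FINAL (1)(c) r3)
credits; every combination of the six classes (slice licence · SRM · within-place financing · partial credit · across-place netting · and, on the
requirement side only, κ′ laws) certifies cell by cell at most the cell's price (abc-iut-rh2-T-1 class laws `demand_le_priceCap_of_hullCellδ` /
`covered_le_priceCap` / `surplus_le_priceCap`; abc-iut-topt-pv-2 `kept_le_surplusValue`: kept `≤ mass(σ) + C_σ ≤ Π`), hence at most `ENV(s)` in total
(`combination_le_envelope`). The REQUIREMENT is the demand total `DEM(s) = s·Σ_w c_w·m_w·L(L−1)(2L+5)/6` minus a height-free tolerance `tol`.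

WHAT IS PROVED (namespace `Summit.ABC.IUTFork.Repair.RH.HeightScalingBarrierDatum`; integers per place, reals across places; 0 `sorry`):
* §1 ONE PLACE, height-free caps on the price total, SHARP in the residue: **`two_mul_sum_price_le_sharp`** `2·Σ_{j≤L} price_j ≤ (δ+G)·L(L+1) + 2G·L + 2(e−1)·L`
  at EVERY depth (the linear cap `(δ+2G+e−1)·L(L+1)` of `RHHullCellSlackSum.two_mul_sum_price_le` / rh2-T-1 `two_mul_sum_price_le_cap` over-counts `G` and `e−1`
  by a factor `≈ L/2`; this one is attained up to the residues), next to the library's lower cap `sum_price_ge` `(δ+G)·L(L+1) + 2G·L ≤ 2·Σ price`: the two caps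
  differ by EXACTLY `2(e−1)·L`, so the place's price total is pinned, height-free, in a band of width `(e−1)·L`; `six_mul_sum_demand_dilate`
  (`6·Σ_j (j²−1)·(s·m) = s·m·L(L−1)(2L+5)`).
* §2 THE DATUM: **`envelope_le_capPlus`** / **`capMinus_le_envelope`** (weighted sums, `c_w ≥ 0`), **`demand_total_dilate`**, **`combination_le_envelope`**.
* §3 THE BARRIER AT THE DATUM LEVEL WITH EXPLICIT THRESHOLDS: **`envelope_add_tol_lt_demand_of_lt`** — if
  `3·Σ_w c_w·((δ_w+G_w)L(L+1) + 2G_wL + 2(e_w−1)L) + 6·tol < s·Σ_w c_w·m_w·L(L−1)(2L+5)` then `ENV(s) + tol < DEM(s)`: beyond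
  `s₀⁺ := (3·CAP⁺ + 6·tol)/M₆` NO combination of the six classes closes the requirement (every integer dilation; «cannot close at any height ≥ h₀ = s₀⁺·h(1)»);
  **`demand_le_envelope_of_le`** — if `s·M₆ ≤ 3·Σ_w c_w·((δ_w+G_w)L(L+1) + 2G_wL)` then `DEM(s) ≤ ENV(s)`: below `s₀⁻ := 3·CAP⁻/M₆` the netted inequality HOLDS
  (the tabulated, content-free side: «ε = 0 on 216/216», FINAL (1)(d)); **`crossing_bracket`**: both in one statement — FINAL (1)(e)'s crossing `s×` (numerics of
  record: medians 1.8226 FREY133 / 3.8306 HEX79 / 1.9972 FREY482, exponent −1) lies, datum by datum, in the CLOSED-FORM bracket `[s₀⁻, s₀⁺]` whose two ends differ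
  by `(6·Σ_w c_w(e_w−1)L + 6·tol)/M₆` only.
* §4 THE WORKED PLACE as a one-place datum (FREY `p = 7`, `l = 107`: `e = 1605`, `m = 210`, `δ = 1604`, `r_in = 268`, `r_out = −4472`, `L = 53`, `c = 1`, `tol = 0`;
  abc-iut-topt-pv-2 p490925): `frey7_l107_caps` (`CAP⁺ = 9 414 496`, `CAP⁻ = 9 329 484`, `M₆/6 = 10 707 060` by `decide`/`norm_num`) and
  **`frey7_l107_netted_fails_all_dilations`**: the §3 hypothesis holds at every `s ≥ 1` (`3·2·9 414 496 < 6·10 707 060·s`), so at this place the envelope never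
  closes the tol-free requirement on the whole ray (`s₀⁺ = 0.8793 < 1`; consistent with p531802 §3 and with Π(1) = 9 374 578 ∈ [CAP⁻, CAP⁺]).
DELIBERATELY NOT HERE: the typed dilation of a `Cor312.Setting` (none exists; the ray is the integer cell model of record, R78), datum tables of `s₀^±` (numerics
seats: D1/D2-EXP/assembler), any abc endpoint, κ′ ≠ 2 demand laws (abc-iut-rh2-w-1 D2-EXP-6: they change `M₆` only, the envelope is untouched).
HONEST FRAMING: integer/real arithmetic about OUR typed cell currency; «closes»/«fails» concern the certified object classes' envelope against OUR requirement,
not [IUTchIII] Cor. 3.12 in print; nothing here asserts that abc is proved or refuted, or that Cor. 3.12 / [IUTchIV] Thm. 1.10 holds or fails at any datum,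
or takes a side on any author; the cell formula is a CONJECTURED column formula of OUR typed hull (refuted-as-typed ≠ refuted-in-print); computed ≠ proved
for the bed link (R-W certificate), here the arithmetic is proved. [folklore] throughout; [claim: Mochizuki2012, status: disputed] for every IUT locution.
-/

namespace Summit.ABC.IUTFork.Repair.RH.HeightScalingBarrierDatum

open Finset
open Summit.ABC.IUTFork.Repair.RH.DiffPricedHull Summit.ABC.IUTFork.Repair.RH.HullCellSlice
  Summit.ABC.IUTFork.Repair.RH.HullCellSlackSum

/-! ## §1. One place: the price total is height-free, pinned between two caps `(e−1)·L` apart; the demand total is the depth times a cubic -/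

/-- **SHARP HEIGHT-FREE UPPER CAP on a place's price total**: `2·Σ_{j=1}^{L} price_j ≤ (δ + G)·L(L+1) + 2G·L + 2(e−1)·L` (`G = r_in − r_out`, `0 < e`;
any depth `m`, any signs) — termwise `ρ_j ≤ e − 1` (`RHHullCellSlice.gain_bounds`) and the triangle number `RHHullCellSlackSum.two_mul_sum_labels_eq`.
[folklore] -/
theorem two_mul_sum_price_le_sharp {e : ℤ} (he : 0 < e) (m δ rin rout : ℤ) (L : ℕ) :
    2 * ∑ k ∈ range L, ((1 + (k : ℤ)) * δ + (1 + (k : ℤ) + 1) * (rin - rout) +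
        ((1 + (k : ℤ)) ^ 2 * m - (1 + (k : ℤ)) * δ - (1 + (k : ℤ) + 1) * rin) % e) ≤
      (δ + (rin - rout)) * ((L : ℤ) * (L + 1)) + 2 * (rin - rout) * L + 2 * (e - 1) * L := by
  have hsum : ∑ k ∈ range L, ((1 + (k : ℤ)) * δ + (1 + (k : ℤ) + 1) * (rin - rout) +
        ((1 + (k : ℤ)) ^ 2 * m - (1 + (k : ℤ)) * δ - (1 + (k : ℤ) + 1) * rin) % e) ≤
      ∑ k ∈ range L, ((δ + (rin - rout)) * (1 + (k : ℤ)) + (rin - rout) + (e - 1)) :=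
    sum_le_sum fun k _ => by
      have h := (gain_bounds he m (1 + (k : ℤ)) δ rin).2
      nlinarith
  have hlin : ∑ k ∈ range L, ((δ + (rin - rout)) * (1 + (k : ℤ)) + (rin - rout) + (e - 1)) =
      (δ + (rin - rout)) * ∑ k ∈ range L, (1 + (k : ℤ)) + ((rin - rout) + (e - 1)) * L := by
    rw [sum_add_distrib, sum_add_distrib, mul_sum, sum_const, sum_const, card_range]
    simp only [nsmul_eq_mul]
    ring
  have hlab : 2 * ∑ k ∈ range L, (1 + (k : ℤ)) = (L : ℤ) * (L + 1) := by
    have h := two_mul_sum_labels_eq 0 L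
    simp only [zero_add, mul_zero] at h
    rw [h]
  calc 2 * ∑ k ∈ range L, ((1 + (k : ℤ)) * δ + (1 + (k : ℤ) + 1) * (rin - rout) +
          ((1 + (k : ℤ)) ^ 2 * m - (1 + (k : ℤ)) * δ - (1 + (k : ℤ) + 1) * rin) % e)
        ≤ 2 * ((δ + (rin - rout)) * ∑ k ∈ range L, (1 + (k : ℤ)) + ((rin - rout) + (e - 1)) * L) := by
          linarith [hsum, hlin]
    _ = (δ + (rin - rout)) * (2 * ∑ k ∈ range L, (1 + (k : ℤ))) + 2 * (rin - rout) * L + 2 * (e - 1) * L := by ring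
    _ = (δ + (rin - rout)) * ((L : ℤ) * (L + 1)) + 2 * (rin - rout) * L + 2 * (e - 1) * L := by rw [hlab]

/-- **HEIGHT-FREE LOWER CAP** (the library's `sum_price_ge` at `J = 0`, restated in this file's label spelling `j = 1 + k`):
`(δ + G)·L(L+1) + 2G·L ≤ 2·Σ_{j=1}^{L} price_j` (`0 < e`; any depth). [folklore] -/
theorem capMinus_le_two_mul_sum_price {e : ℤ} (he : 0 < e) (m δ rin rout : ℤ) (L : ℕ) :
    (δ + (rin - rout)) * ((L : ℤ) * (L + 1)) + 2 * (rin - rout) * L ≤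
      2 * ∑ k ∈ range L, ((1 + (k : ℤ)) * δ + (1 + (k : ℤ) + 1) * (rin - rout) +
        ((1 + (k : ℤ)) ^ 2 * m - (1 + (k : ℤ)) * δ - (1 + (k : ℤ) + 1) * rin) % e) := by
  have h := sum_price_ge (e := e) (m := m) (δ := δ) (rin := rin) (rout := rout) (J := 0) he L
  simp only [zero_add, mul_zero] at h
  exact h

/-- **The demand total is the depth times a cubic**: `6·Σ_{j=1}^{L} (j²−1)·(s·m) = (s·m)·L(L−1)(2L+5)` (`RHHullCellSlackSum.six_mul_sum_demand_eq` at `J = 0`).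
[folklore] -/
theorem six_mul_sum_demand_dilate (s m : ℤ) (L : ℕ) :
    6 * ∑ k ∈ range L, (((1 + (k : ℤ)) ^ 2 - 1) * (s * m)) = s * m * ((L : ℤ) * (L - 1) * (2 * L + 5)) := by
  have h := six_mul_sum_demand_eq 0 (s * m) L
  simp only [zero_add, zero_sub, mul_zero, zero_mul, sub_zero] at h
  linear_combination h

/-! ## §2. The datum: weighted sums over finitely many conjugate-fibre places -/

variable {n : ℕ}

/-- **ENVELOPE ≤ CAP⁺** (height-free): with weights `c_w ≥ 0`,
`2·Σ_w c_w·Σ_j price_j(w, s) ≤ Σ_w c_w·((δ_w+G_w)L(L+1) + 2G_wL + 2(e_w−1)L)` at EVERY dilation `s`. [folklore] -/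
theorem envelope_le_capPlus (e m δ rin rout : Fin n → ℤ) (c : Fin n → ℝ) (L : ℕ) (s : ℤ)
    (he : ∀ w, 0 < e w) (hc : ∀ w, 0 ≤ c w) :
    2 * ∑ w, c w * ((∑ k ∈ range L, ((1 + (k : ℤ)) * δ w + (1 + (k : ℤ) + 1) * (rin w - rout w) +
        ((1 + (k : ℤ)) ^ 2 * (s * m w) - (1 + (k : ℤ)) * δ w - (1 + (k : ℤ) + 1) * rin w) % e w) : ℤ) : ℝ) ≤
      ∑ w, c w * (((δ w + (rin w - rout w)) * ((L : ℤ) * (L + 1)) + 2 * (rin w - rout w) * L + 2 * (e w - 1) * L : ℤ) : ℝ) := by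
  rw [mul_sum]
  refine sum_le_sum fun w _ => ?_
  have h := two_mul_sum_price_le_sharp (he w) (s * m w) (δ w) (rin w) (rout w) L
  have h' : (2 : ℝ) * ((∑ k ∈ range L, ((1 + (k : ℤ)) * δ w + (1 + (k : ℤ) + 1) * (rin w - rout w) +
        ((1 + (k : ℤ)) ^ 2 * (s * m w) - (1 + (k : ℤ)) * δ w - (1 + (k : ℤ) + 1) * rin w) % e w) : ℤ) : ℝ) ≤
      (((δ w + (rin w - rout w)) * ((L : ℤ) * (L + 1)) + 2 * (rin w - rout w) * L + 2 * (e w - 1) * L : ℤ) : ℝ) := by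
    exact_mod_cast h
  nlinarith [hc w, h']

/-- **CAP⁻ ≤ ENVELOPE** (height-free): `Σ_w c_w·((δ_w+G_w)L(L+1) + 2G_wL) ≤ 2·Σ_w c_w·Σ_j price_j(w, s)` at EVERY dilation `s`. [folklore] -/
theorem capMinus_le_envelope (e m δ rin rout : Fin n → ℤ) (c : Fin n → ℝ) (L : ℕ) (s : ℤ)
    (he : ∀ w, 0 < e w) (hc : ∀ w, 0 ≤ c w) :
    ∑ w, c w * (((δ w + (rin w - rout w)) * ((L : ℤ) * (L + 1)) + 2 * (rin w - rout w) * L : ℤ) : ℝ) ≤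
      2 * ∑ w, c w * ((∑ k ∈ range L, ((1 + (k : ℤ)) * δ w + (1 + (k : ℤ) + 1) * (rin w - rout w) +
        ((1 + (k : ℤ)) ^ 2 * (s * m w) - (1 + (k : ℤ)) * δ w - (1 + (k : ℤ) + 1) * rin w) % e w) : ℤ) : ℝ) := by
  rw [mul_sum]
  refine sum_le_sum fun w _ => ?_
  have h := capMinus_le_two_mul_sum_price (he w) (s * m w) (δ w) (rin w) (rout w) L
  have h' : (((δ w + (rin w - rout w)) * ((L : ℤ) * (L + 1)) + 2 * (rin w - rout w) * L : ℤ) : ℝ) ≤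
      (2 : ℝ) * ((∑ k ∈ range L, ((1 + (k : ℤ)) * δ w + (1 + (k : ℤ) + 1) * (rin w - rout w) +
        ((1 + (k : ℤ)) ^ 2 * (s * m w) - (1 + (k : ℤ)) * δ w - (1 + (k : ℤ) + 1) * rin w) % e w) : ℤ) : ℝ) := by
    exact_mod_cast h
  nlinarith [hc w, h']

/-- **The datum's demand total is the dilation times a height-free number**:
`6·Σ_w c_w·Σ_j (j²−1)·(s·m_w) = s·Σ_w c_w·m_w·L(L−1)(2L+5)`. [folklore] -/
theorem demand_total_dilate (m : Fin n → ℤ) (c : Fin n → ℝ) (L : ℕ) (s : ℤ) :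
    6 * ∑ w, c w * ((∑ k ∈ range L, (((1 + (k : ℤ)) ^ 2 - 1) * (s * m w)) : ℤ) : ℝ) =
      (s : ℝ) * ∑ w, c w * ((m w * ((L : ℤ) * (L - 1) * (2 * L + 5)) : ℤ) : ℝ) := by
  rw [mul_sum, mul_sum]
  refine sum_congr rfl fun w _ => ?_
  have h := six_mul_sum_demand_dilate s (m w) L
  have h' : (6 : ℝ) * ((∑ k ∈ range L, (((1 + (k : ℤ)) ^ 2 - 1) * (s * m w)) : ℤ) : ℝ) =
      ((s * m w * ((L : ℤ) * (L - 1) * (2 * L + 5)) : ℤ) : ℝ) := by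
    exact_mod_cast h
  push_cast at h' ⊢
  linear_combination c w * h'

/-- **EVERY COMBINATION IS UNDER THE ENVELOPE**: if a combination of objects certifies, cell by cell, masses `a_w(j) ≤ price_j(w, s)` (the class laws of
abc-iut-rh2-T-1 `RHHeightScaling` §2: licensed demand / covered share / moved surplus ≤ price; abc-iut-topt-pv-2 `kept_le_surplusValue`), then its weighted
total is at most `ENV(s)` — so the full-price envelope settles «every combination of objects of the six classes» at once. [folklore] -/
theorem combination_le_envelope (e m δ rin rout : Fin n → ℤ) (c : Fin n → ℝ) (L : ℕ) (s : ℤ) (a : Fin n → ℕ → ℝ)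
    (hc : ∀ w, 0 ≤ c w)
    (ha : ∀ w, ∀ k ∈ range L, a w k ≤ (((1 + (k : ℤ)) * δ w + (1 + (k : ℤ) + 1) * (rin w - rout w) +
        ((1 + (k : ℤ)) ^ 2 * (s * m w) - (1 + (k : ℤ)) * δ w - (1 + (k : ℤ) + 1) * rin w) % e w : ℤ) : ℝ)) :
    ∑ w, c w * ∑ k ∈ range L, a w k ≤
      ∑ w, c w * ((∑ k ∈ range L, ((1 + (k : ℤ)) * δ w + (1 + (k : ℤ) + 1) * (rin w - rout w) +
        ((1 + (k : ℤ)) ^ 2 * (s * m w) - (1 + (k : ℤ)) * δ w - (1 + (k : ℤ) + 1) * rin w) % e w) : ℤ) : ℝ) := by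
  refine sum_le_sum fun w _ => mul_le_mul_of_nonneg_left ?_ (hc w)
  rw [Int.cast_sum]
  exact sum_le_sum fun k hk => ha w k hk

/-! ## §3. The barrier at the datum level: explicit thresholds on both sides of the crossing -/

/-- **THE DATUM-LEVEL BARRIER, explicit threshold.** If
`3·Σ_w c_w·((δ_w+G_w)L(L+1) + 2G_wL + 2(e_w−1)L) + 6·tol < s·Σ_w c_w·m_w·L(L−1)(2L+5)` — i.e. the dilation `s` is beyond
`s₀⁺ := (3·CAP⁺ + 6·tol)/M₆` — then the full-price envelope plus the tolerance falls STRICTLY SHORT of the demand: `ENV(s) + tol < DEM(s)`. By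
`combination_le_envelope` no combination of objects of the six classes closes the requirement at any such `s` («cannot close at any height ≥ h₀»;
conductor-type credit vs `T ∝ h`, FINAL (1)(d); abstract form p531802 `not_closedBy_of_heightFree`). [folklore] -/
theorem envelope_add_tol_lt_demand_of_lt (e m δ rin rout : Fin n → ℤ) (c : Fin n → ℝ) (L : ℕ) (s : ℤ) (tol : ℝ)
    (he : ∀ w, 0 < e w) (hc : ∀ w, 0 ≤ c w)
    (hs : 3 * ∑ w, c w * (((δ w + (rin w - rout w)) * ((L : ℤ) * (L + 1)) + 2 * (rin w - rout w) * L + 2 * (e w - 1) * L : ℤ) : ℝ)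
        + 6 * tol < (s : ℝ) * ∑ w, c w * ((m w * ((L : ℤ) * (L - 1) * (2 * L + 5)) : ℤ) : ℝ)) :
    ∑ w, c w * ((∑ k ∈ range L, ((1 + (k : ℤ)) * δ w + (1 + (k : ℤ) + 1) * (rin w - rout w) +
        ((1 + (k : ℤ)) ^ 2 * (s * m w) - (1 + (k : ℤ)) * δ w - (1 + (k : ℤ) + 1) * rin w) % e w) : ℤ) : ℝ) + tol <
      ∑ w, c w * ((∑ k ∈ range L, (((1 + (k : ℤ)) ^ 2 - 1) * (s * m w)) : ℤ) : ℝ) := by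
  have h1 := envelope_le_capPlus e m δ rin rout c L s he hc
  have h2 := demand_total_dilate m c L s
  linarith

/-- **THE TABULATED SIDE, explicit threshold.** If `s·Σ_w c_w·m_w·L(L−1)(2L+5) ≤ 3·Σ_w c_w·((δ_w+G_w)L(L+1) + 2G_wL)` — `s` below `s₀⁻ := 3·CAP⁻/M₆` —
then the demand fits under the envelope: `DEM(s) ≤ ENV(s)` (the netted exact-cell inequality HOLDS, content-free; «ε = 0 on 216/216 + 565/565» at `s = 1`,
FINAL (1)(d); one-place form abc-iut-rh2-T-1 `sum_demand_sub_price_nonpos_of_le`). [folklore] -/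
theorem demand_le_envelope_of_le (e m δ rin rout : Fin n → ℤ) (c : Fin n → ℝ) (L : ℕ) (s : ℤ)
    (he : ∀ w, 0 < e w) (hc : ∀ w, 0 ≤ c w)
    (hs : (s : ℝ) * ∑ w, c w * ((m w * ((L : ℤ) * (L - 1) * (2 * L + 5)) : ℤ) : ℝ) ≤
        3 * ∑ w, c w * (((δ w + (rin w - rout w)) * ((L : ℤ) * (L + 1)) + 2 * (rin w - rout w) * L : ℤ) : ℝ)) :
    ∑ w, c w * ((∑ k ∈ range L, (((1 + (k : ℤ)) ^ 2 - 1) * (s * m w)) : ℤ) : ℝ) ≤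
      ∑ w, c w * ((∑ k ∈ range L, ((1 + (k : ℤ)) * δ w + (1 + (k : ℤ) + 1) * (rin w - rout w) +
        ((1 + (k : ℤ)) ^ 2 * (s * m w) - (1 + (k : ℤ)) * δ w - (1 + (k : ℤ) + 1) * rin w) % e w) : ℤ) : ℝ) := by
  have h1 := capMinus_le_envelope e m δ rin rout c L s he hc
  have h2 := demand_total_dilate m c L s
  linarith

/-- **THE CROSSING BRACKET** (both sides in one statement): with `tol ≥ 0`, the netted requirement «`DEM(s) ≤ ENV(s) + tol`» HOLDS at every dilation
`s ≤ s₀⁻ = 3·CAP⁻/M₆` and FAILS at every dilation `s > s₀⁺ = (3·CAP⁺ + 6·tol)/M₆`, where `3·CAP⁺ − 3·CAP⁻ = 6·Σ_w c_w·(e_w−1)·L` — FINAL (1)(e)'s crossing `s×`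
lies in `[s₀⁻, s₀⁺]` datum by datum, in closed form. [folklore] -/
theorem crossing_bracket (e m δ rin rout : Fin n → ℤ) (c : Fin n → ℝ) (L : ℕ) (s : ℤ) (tol : ℝ)
    (he : ∀ w, 0 < e w) (hc : ∀ w, 0 ≤ c w) (htol : 0 ≤ tol) :
    ((s : ℝ) * ∑ w, c w * ((m w * ((L : ℤ) * (L - 1) * (2 * L + 5)) : ℤ) : ℝ) ≤
        3 * ∑ w, c w * (((δ w + (rin w - rout w)) * ((L : ℤ) * (L + 1)) + 2 * (rin w - rout w) * L : ℤ) : ℝ) →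
      ∑ w, c w * ((∑ k ∈ range L, (((1 + (k : ℤ)) ^ 2 - 1) * (s * m w)) : ℤ) : ℝ) ≤
        ∑ w, c w * ((∑ k ∈ range L, ((1 + (k : ℤ)) * δ w + (1 + (k : ℤ) + 1) * (rin w - rout w) +
          ((1 + (k : ℤ)) ^ 2 * (s * m w) - (1 + (k : ℤ)) * δ w - (1 + (k : ℤ) + 1) * rin w) % e w) : ℤ) : ℝ) + tol) ∧
    (3 * ∑ w, c w * (((δ w + (rin w - rout w)) * ((L : ℤ) * (L + 1)) + 2 * (rin w - rout w) * L + 2 * (e w - 1) * L : ℤ) : ℝ)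
        + 6 * tol < (s : ℝ) * ∑ w, c w * ((m w * ((L : ℤ) * (L - 1) * (2 * L + 5)) : ℤ) : ℝ) →
      ¬ (∑ w, c w * ((∑ k ∈ range L, (((1 + (k : ℤ)) ^ 2 - 1) * (s * m w)) : ℤ) : ℝ) ≤
        ∑ w, c w * ((∑ k ∈ range L, ((1 + (k : ℤ)) * δ w + (1 + (k : ℤ) + 1) * (rin w - rout w) +
          ((1 + (k : ℤ)) ^ 2 * (s * m w) - (1 + (k : ℤ)) * δ w - (1 + (k : ℤ) + 1) * rin w) % e w) : ℤ) : ℝ) + tol)) := by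
  refine ⟨fun hs => ?_, fun hs h => ?_⟩
  · have := demand_le_envelope_of_le e m δ rin rout c L s he hc hs
    linarith
  · have := envelope_add_tol_lt_demand_of_lt e m δ rin rout c L s tol he hc hs
    linarith

/-! ## §4. The worked place FREY `p = 7`, `l = 107` as a one-place datum (`c = 1`, `tol = 0`) -/

/-- The worked place's caps and slope: `CAP⁺ = ((δ+G)·L(L+1) + 2GL + 2(e−1)L)/2 = 9 414 496`, `CAP⁻ = ((δ+G)·L(L+1) + 2GL)/2 = 9 329 484`,
`M₆/6 = m·L(L−1)(2L+5)/6 = 10 707 060` (`e = 1605`, `m = 210`, `δ = 1604`, `r_in = 268`, `r_out = −4472`, `L = 53`; cf. p490925 `frey7_l107_totalMass`,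
`frey7_l107_priceTotal` `Π(1) = 9 374 578 ∈ [CAP⁻, CAP⁺]`). [folklore] -/
theorem frey7_l107_caps :
    ((1604 : ℤ) + (268 - (-4472))) * (53 * (53 + 1)) + 2 * (268 - (-4472)) * 53 + 2 * (1605 - 1) * 53 = 2 * 9414496 ∧
    ((1604 : ℤ) + (268 - (-4472))) * (53 * (53 + 1)) + 2 * (268 - (-4472)) * 53 = 2 * 9329484 ∧
    (210 : ℤ) * (53 * (53 - 1) * (2 * 53 + 5)) = 6 * 10707060 := by
  norm_num

/-- **At the worked place the netted requirement fails at EVERY dilation `s ≥ 1`**: the §3 hypothesis `3·2·CAP⁺ < s·M₆` reads `56 486 976 < 64 242 360·s`,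
true from `s = 1` on (`s₀⁺ = 0.8793`), so — crediting all 53 cells their full exact price — the demand is not met anywhere on the ray (one-place datum, weight
`1`, `tol = 0`). [folklore] -/
theorem frey7_l107_netted_fails_all_dilations (s : ℤ) (hs : 1 ≤ s) :
    ∑ _w : Fin 1, (1 : ℝ) * ((∑ k ∈ range 53, ((1 + (k : ℤ)) * 1604 + (1 + (k : ℤ) + 1) * (268 - (-4472)) +
        ((1 + (k : ℤ)) ^ 2 * (s * 210) - (1 + (k : ℤ)) * 1604 - (1 + (k : ℤ) + 1) * 268) % 1605) : ℤ) : ℝ) + 0 <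
      ∑ _w : Fin 1, (1 : ℝ) * ((∑ k ∈ range 53, (((1 + (k : ℤ)) ^ 2 - 1) * (s * 210)) : ℤ) : ℝ) := by
  have h := envelope_add_tol_lt_demand_of_lt (n := 1) (fun _ => 1605) (fun _ => 210) (fun _ => 1604) (fun _ => 268)
    (fun _ => -4472) (fun _ => 1) 53 s 0 (fun _ => by norm_num) (fun _ => zero_le_one) ?_
  · simpa using h
  · have hs' : (1 : ℝ) ≤ (s : ℝ) := by exact_mod_cast hs
    simp only [Finset.sum_const, Finset.card_univ, Fintype.card_fin, one_mul, nsmul_eq_mul, Nat.cast_one]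
    push_cast
    nlinarith


/-! ## §5. APPEND (abc-iut-rh2-w-2 g6, same day): THE BARRIER IS UNIFORM OVER THE WEIGHT LAW — any label weights `w(j)` in place of `j²`
(axis-B/C knob k1: `j² ↦ ⌈j^κ′⌉`, κ′ ∈ {1, 3/2, 5/2}, shifted / affine laws; D-0130 (D1)/(D2) «the κ≠2 weight laws of axis C as extra decision variables»).
Under a law `w` the cell's q-side exponent `j²·m` becomes `w(j)·m`: the DEMAND is `(w(j) − 1)·s·m` and the exact price keeps the SAME height-free part
`j·δ + (j+1)·G` plus a residue `(w(j)·s·m − j·δ − (j+1)·r_in) mod e ∈ [0, e−1]` — so the envelope caps of §1–§2 are UNCHANGED and only the demand slope moves: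
exponent `−1` for every weight law, threshold `s₀⁺(w) = (CAP⁺ + tol)/(Σ_w c_w·m_w·W_L)`, `W_L := Σ_{j≤L} (w(j) − 1)`. -/

/-- **Height-free cap under ANY weight law**: with the residue taken on `w(j)·(s·m) − j·δ − (j+1)·r_in` (any integer-valued law `w`),
`2·Σ_{j=1}^{L} price^w_j(s) ≤ (δ+G)·L(L+1) + 2G·L + 2(e−1)·L` at every dilation `s` (`0 < e`). [folklore] -/
theorem two_mul_sum_priceW_le_sharp {e : ℤ} (he : 0 < e) (w : ℤ → ℤ) (s m δ rin rout : ℤ) (L : ℕ) :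
    2 * ∑ k ∈ range L, ((1 + (k : ℤ)) * δ + (1 + (k : ℤ) + 1) * (rin - rout) +
        (w (1 + (k : ℤ)) * (s * m) - (1 + (k : ℤ)) * δ - (1 + (k : ℤ) + 1) * rin) % e) ≤
      (δ + (rin - rout)) * ((L : ℤ) * (L + 1)) + 2 * (rin - rout) * L + 2 * (e - 1) * L := by
  have hsum : ∑ k ∈ range L, ((1 + (k : ℤ)) * δ + (1 + (k : ℤ) + 1) * (rin - rout) +
        (w (1 + (k : ℤ)) * (s * m) - (1 + (k : ℤ)) * δ - (1 + (k : ℤ) + 1) * rin) % e) ≤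
      ∑ k ∈ range L, ((δ + (rin - rout)) * (1 + (k : ℤ)) + (rin - rout) + (e - 1)) :=
    sum_le_sum fun k _ => by
      have h := Int.emod_lt_of_pos (w (1 + (k : ℤ)) * (s * m) - (1 + (k : ℤ)) * δ - (1 + (k : ℤ) + 1) * rin) he
      nlinarith
  have hlin : ∑ k ∈ range L, ((δ + (rin - rout)) * (1 + (k : ℤ)) + (rin - rout) + (e - 1)) =
      (δ + (rin - rout)) * ∑ k ∈ range L, (1 + (k : ℤ)) + ((rin - rout) + (e - 1)) * L := by
    rw [sum_add_distrib, sum_add_distrib, mul_sum, sum_const, sum_const, card_range]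
    simp only [nsmul_eq_mul]
    ring
  have hlab : 2 * ∑ k ∈ range L, (1 + (k : ℤ)) = (L : ℤ) * (L + 1) := by
    have h := two_mul_sum_labels_eq 0 L
    simp only [zero_add, mul_zero] at h
    rw [h]
  calc 2 * ∑ k ∈ range L, ((1 + (k : ℤ)) * δ + (1 + (k : ℤ) + 1) * (rin - rout) +
          (w (1 + (k : ℤ)) * (s * m) - (1 + (k : ℤ)) * δ - (1 + (k : ℤ) + 1) * rin) % e)
        ≤ 2 * ((δ + (rin - rout)) * ∑ k ∈ range L, (1 + (k : ℤ)) + ((rin - rout) + (e - 1)) * L) := by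
          linarith [hsum, hlin]
    _ = (δ + (rin - rout)) * (2 * ∑ k ∈ range L, (1 + (k : ℤ))) + 2 * (rin - rout) * L + 2 * (e - 1) * L := by ring
    _ = (δ + (rin - rout)) * ((L : ℤ) * (L + 1)) + 2 * (rin - rout) * L + 2 * (e - 1) * L := by rw [hlab]

/-- **The demand under a weight law is the dilation times a height-free number**: `Σ_{j≤L} (w(j) − 1)·(s·m) = s·m·W_L`, `W_L = Σ_{j≤L} (w(j) − 1)`. [folklore] -/
theorem sum_demandW_dilate (w : ℤ → ℤ) (s m : ℤ) (L : ℕ) :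
    ∑ k ∈ range L, ((w (1 + (k : ℤ)) - 1) * (s * m)) = s * m * ∑ k ∈ range L, (w (1 + (k : ℤ)) - 1) := by
  rw [mul_sum]
  exact sum_congr rfl fun k _ => by ring

/-- **THE DATUM-LEVEL BARRIER FOR EVERY WEIGHT LAW, explicit threshold.** For any label-weight law `w` (κ′ knob), weights `c_v ≥ 0` and a height-free
tolerance: if `Σ_v c_v·((δ_v+G_v)L(L+1) + 2G_vL + 2(e_v−1)L) + 2·tol < 2·s·Σ_v c_v·m_v·W_L` then the full-price envelope plus the tolerance falls STRICTLY
short of the `w`-demand — no combination of the six classes closes the `w`-requirement at any such dilation; exponent `−1` uniformly in the law, only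
the slope `Σ_v c_v m_v W_L` depends on `w` (for `w(j) = j²`, `6·W_L = L(L−1)(2L+5)` and this is §3). [folklore] -/
theorem envelopeW_add_tol_lt_demandW_of_lt (w : ℤ → ℤ) (e m δ rin rout : Fin n → ℤ) (c : Fin n → ℝ) (L : ℕ) (s : ℤ) (tol : ℝ)
    (he : ∀ v, 0 < e v) (hc : ∀ v, 0 ≤ c v)
    (hs : ∑ v, c v * (((δ v + (rin v - rout v)) * ((L : ℤ) * (L + 1)) + 2 * (rin v - rout v) * L + 2 * (e v - 1) * L : ℤ) : ℝ)
        + 2 * tol < 2 * ((s : ℝ) * ∑ v, c v * ((m v * ∑ k ∈ range L, (w (1 + (k : ℤ)) - 1) : ℤ) : ℝ))) :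
    ∑ v, c v * ((∑ k ∈ range L, ((1 + (k : ℤ)) * δ v + (1 + (k : ℤ) + 1) * (rin v - rout v) +
        (w (1 + (k : ℤ)) * (s * m v) - (1 + (k : ℤ)) * δ v - (1 + (k : ℤ) + 1) * rin v) % e v) : ℤ) : ℝ) + tol <
      ∑ v, c v * ((∑ k ∈ range L, ((w (1 + (k : ℤ)) - 1) * (s * m v)) : ℤ) : ℝ) := by
  -- envelope ≤ CAP⁺/2, place by place
  have henv : 2 * ∑ v, c v * ((∑ k ∈ range L, ((1 + (k : ℤ)) * δ v + (1 + (k : ℤ) + 1) * (rin v - rout v) +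
        (w (1 + (k : ℤ)) * (s * m v) - (1 + (k : ℤ)) * δ v - (1 + (k : ℤ) + 1) * rin v) % e v) : ℤ) : ℝ) ≤
      ∑ v, c v * (((δ v + (rin v - rout v)) * ((L : ℤ) * (L + 1)) + 2 * (rin v - rout v) * L + 2 * (e v - 1) * L : ℤ) : ℝ) := by
    rw [mul_sum]
    refine sum_le_sum fun v _ => ?_
    have h := two_mul_sum_priceW_le_sharp (he v) w s (m v) (δ v) (rin v) (rout v) L
    have h' : (2 : ℝ) * ((∑ k ∈ range L, ((1 + (k : ℤ)) * δ v + (1 + (k : ℤ) + 1) * (rin v - rout v) +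
        (w (1 + (k : ℤ)) * (s * m v) - (1 + (k : ℤ)) * δ v - (1 + (k : ℤ) + 1) * rin v) % e v) : ℤ) : ℝ) ≤
      (((δ v + (rin v - rout v)) * ((L : ℤ) * (L + 1)) + 2 * (rin v - rout v) * L + 2 * (e v - 1) * L : ℤ) : ℝ) := by
      exact_mod_cast h
    nlinarith [hc v, h']
  -- demand = s · Σ c m W
  have hdem : ∑ v, c v * ((∑ k ∈ range L, ((w (1 + (k : ℤ)) - 1) * (s * m v)) : ℤ) : ℝ) =
      (s : ℝ) * ∑ v, c v * ((m v * ∑ k ∈ range L, (w (1 + (k : ℤ)) - 1) : ℤ) : ℝ) := by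
    rw [mul_sum]
    refine sum_congr rfl fun v _ => ?_
    rw [sum_demandW_dilate w s (m v) L]
    push_cast
    ring
  linarith [henv, hdem]

/-- **The tabulated side for every weight law**: if `2·s·Σ_v c_v·m_v·W_L ≤ Σ_v c_v·((δ_v+G_v)L(L+1) + 2G_vL)` (below `s₀⁻(w) = CAP⁻/(Σ c m W_L)`) the
`w`-demand fits under the envelope (the residues are `≥ 0` for any law). [folklore] -/
theorem demandW_le_envelopeW_of_le (w : ℤ → ℤ) (e m δ rin rout : Fin n → ℤ) (c : Fin n → ℝ) (L : ℕ) (s : ℤ)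
    (he : ∀ v, 0 < e v) (hc : ∀ v, 0 ≤ c v)
    (hs : 2 * ((s : ℝ) * ∑ v, c v * ((m v * ∑ k ∈ range L, (w (1 + (k : ℤ)) - 1) : ℤ) : ℝ)) ≤
        ∑ v, c v * (((δ v + (rin v - rout v)) * ((L : ℤ) * (L + 1)) + 2 * (rin v - rout v) * L : ℤ) : ℝ)) :
    ∑ v, c v * ((∑ k ∈ range L, ((w (1 + (k : ℤ)) - 1) * (s * m v)) : ℤ) : ℝ) ≤
      ∑ v, c v * ((∑ k ∈ range L, ((1 + (k : ℤ)) * δ v + (1 + (k : ℤ) + 1) * (rin v - rout v) +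
        (w (1 + (k : ℤ)) * (s * m v) - (1 + (k : ℤ)) * δ v - (1 + (k : ℤ) + 1) * rin v) % e v) : ℤ) : ℝ) := by
  have henv : ∑ v, c v * (((δ v + (rin v - rout v)) * ((L : ℤ) * (L + 1)) + 2 * (rin v - rout v) * L : ℤ) : ℝ) ≤
      2 * ∑ v, c v * ((∑ k ∈ range L, ((1 + (k : ℤ)) * δ v + (1 + (k : ℤ) + 1) * (rin v - rout v) +
        (w (1 + (k : ℤ)) * (s * m v) - (1 + (k : ℤ)) * δ v - (1 + (k : ℤ) + 1) * rin v) % e v) : ℤ) : ℝ) := by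
    rw [mul_sum]
    refine sum_le_sum fun v _ => ?_
    -- lower cap place by place: residues ≥ 0
    have hlo : (δ v + (rin v - rout v)) * ((L : ℤ) * (L + 1)) + 2 * (rin v - rout v) * L ≤
        2 * ∑ k ∈ range L, ((1 + (k : ℤ)) * δ v + (1 + (k : ℤ) + 1) * (rin v - rout v) +
          (w (1 + (k : ℤ)) * (s * m v) - (1 + (k : ℤ)) * δ v - (1 + (k : ℤ) + 1) * rin v) % e v) := by
      have hsum : ∑ k ∈ range L, ((δ v + (rin v - rout v)) * (1 + (k : ℤ)) + (rin v - rout v)) ≤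
          ∑ k ∈ range L, ((1 + (k : ℤ)) * δ v + (1 + (k : ℤ) + 1) * (rin v - rout v) +
            (w (1 + (k : ℤ)) * (s * m v) - (1 + (k : ℤ)) * δ v - (1 + (k : ℤ) + 1) * rin v) % e v) :=
        sum_le_sum fun k _ => by
          have h0 := Int.emod_nonneg (w (1 + (k : ℤ)) * (s * m v) - (1 + (k : ℤ)) * δ v - (1 + (k : ℤ) + 1) * rin v) (he v).ne'
          nlinarith
      have hlin : ∑ k ∈ range L, ((δ v + (rin v - rout v)) * (1 + (k : ℤ)) + (rin v - rout v)) =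
          (δ v + (rin v - rout v)) * ∑ k ∈ range L, (1 + (k : ℤ)) + (rin v - rout v) * L := by
        rw [sum_add_distrib, mul_sum, sum_const, card_range]
        simp only [nsmul_eq_mul]
        ring
      have hlab : 2 * ∑ k ∈ range L, (1 + (k : ℤ)) = (L : ℤ) * (L + 1) := by
        have h := two_mul_sum_labels_eq 0 L
        simp only [zero_add, mul_zero] at h
        rw [h]
      calc (δ v + (rin v - rout v)) * ((L : ℤ) * (L + 1)) + 2 * (rin v - rout v) * L
            = (δ v + (rin v - rout v)) * (2 * ∑ k ∈ range L, (1 + (k : ℤ))) + 2 * (rin v - rout v) * L := by rw [hlab]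
        _ = 2 * ((δ v + (rin v - rout v)) * ∑ k ∈ range L, (1 + (k : ℤ)) + (rin v - rout v) * L) := by ring
        _ = 2 * ∑ k ∈ range L, ((δ v + (rin v - rout v)) * (1 + (k : ℤ)) + (rin v - rout v)) := by rw [hlin]
        _ ≤ _ := by linarith [hsum]
    have h' : (((δ v + (rin v - rout v)) * ((L : ℤ) * (L + 1)) + 2 * (rin v - rout v) * L : ℤ) : ℝ) ≤
        (2 : ℝ) * ((∑ k ∈ range L, ((1 + (k : ℤ)) * δ v + (1 + (k : ℤ) + 1) * (rin v - rout v) +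
          (w (1 + (k : ℤ)) * (s * m v) - (1 + (k : ℤ)) * δ v - (1 + (k : ℤ) + 1) * rin v) % e v) : ℤ) : ℝ) := by
      exact_mod_cast hlo
    nlinarith [hc v, h']
  have hdem : ∑ v, c v * ((∑ k ∈ range L, ((w (1 + (k : ℤ)) - 1) * (s * m v)) : ℤ) : ℝ) =
      (s : ℝ) * ∑ v, c v * ((m v * ∑ k ∈ range L, (w (1 + (k : ℤ)) - 1) : ℤ) : ℝ) := by
    rw [mul_sum]
    refine sum_congr rfl fun v _ => ?_
    rw [sum_demandW_dilate w s (m v) L]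
    push_cast
    ring
  linarith [henv, hdem]

/-- **Calibration**: the square law `w(j) = j²` recovers §3's slope — `6·Σ_{j≤L} (j² − 1) = L(L−1)(2L+5)` (`RHHullCellSlackSum.six_mul_sum_demand_eq` at
`m = 1`, `J = 0`). [folklore] -/
theorem six_mul_sum_sqLaw_eq (L : ℕ) :
    6 * ∑ k ∈ range L, ((fun j : ℤ => j ^ 2) (1 + (k : ℤ)) - 1) = (L : ℤ) * (L - 1) * (2 * L + 5) := by
  have h := six_mul_sum_demand_eq 0 1 L
  simp only [zero_add, zero_sub, mul_zero, zero_mul, sub_zero, mul_one, one_mul] at h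
  simpa using h


end Summit.ABC.IUTFork.Repair.RH.HeightScalingBarrierDatum
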